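import Summits.Ventures.HSemireg.MethodInstanceG6ThetaSecantReachSymbols
import Mathlib.NumberTheory.LegendreSymbol.JacobiSymbol
import Mathlib.Data.Nat.Factorization.Basic
import HarnessLib

/-!
# Venture HSemireg — the QUARTIC SUPPLEMENT to the two-prime reach law of the g = 6 theta-secant method instance:
# `p ≡ 1 (mod 8)`, `(q/p) = +1`, `(q/p)₄ = −1` ⟹ `ℚ(√-pq)` reached — every two-prime row of the census table below `400` is decided by symbols

HONEST FRAMING. Lean index of the computation cell `pub-hsemireg` (seat p8, «Sunday typer § g = 6»; sequel of
`MethodInstanceG6ThetaSecantReachSymbols.lean`). ELEMENTARY NUMBER THEORY only (the quadratic two-prime law's open class, entered with the Jacobi symbol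
and Euler's criterion; Mathlib's Jacobi reciprocity); no variety, sheaf or `Ext` group is constructed and no Weil-class statement is made here except the
one labelled composition in §3 (tier stated there). Nothing here says HC, HC_CM or HC_AV is proved; SPLIT sixfold components only (method-instance reach;
the verdict's deciding rows stay «NO-in-families-tried», candidates 0). Currency as before: «`ℚ(√-d)` reached» = `∃ m k, m even ∧ m² = d·k² + 1`.

THE OPEN CLASS of the quadratic law (predecessor §3, sequel's honest limit): `d = p·q`, `p ≡ 1 (mod 8)`, `q ≡ 3 (mod 4)`, `(q/p) = +1` — there the symbols
`(−1/·)`, `(±2/·)`, `(p/q)` decide nothing (`219` reached, `579` not). ONE LEVEL UP: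
* §1 A JACOBI LEMMA (`jacobiSym_eq_one_of_dvd_mul_sq_sub_one`): `n ∣ p·v² − 1` ⟹ `J(p | n) = 1` (`p·v²` is `1` mod `n` and `v` is prime to `n`).
* §2 THE QUARTIC SUPPLEMENT (`thetaSecant_reaches_two_primes_of_quartic_nonresidue`): for primes `p ≡ 1 (mod 8)`, `q ≡ 3 (mod 4)`, if
  `q^{(p−1)/4} ≡ −1 (mod p)` — `q` is a quadratic but NOT a quartic residue mod `p`, `(q/p)₄ = −1` — then `ℚ(√-pq)` IS REACHED. Proof: a NO certificate has
  the shape `p·v² = q·u² + 1` (predecessor); mod `p`, `q ≡ −u⁻²`, so `(q/p)₄ = q^{(p−1)/4} ≡ u^{−(p−1)/2} = (u/p)` (`(p−1)/4` even); write `u = 2ᵉ·u'`, `u'` odd: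
  `(2/p) = 1` (`p ≡ 1 (mod 8)`) and `(u'/p) = J(p | u')` (Jacobi reciprocity, `p ≡ 1 (mod 4)`) `= 1` by §1 (`u' ∣ q·u² = p·v² − 1`); hence `(q/p)₄ = +1`.
  Cell form `thetaSecant_noCertificate_two_primes_of_quartic_nonresidue`; contrapositive `thetaSecant_quartic_residue_of_certificate` («NOT reached ⟹
  `(q/p)₄ = +1`»).
* §3 CONSEQUENCES FOR THE TABLE: the three composite YES rows below `400` that the quadratic symbols left to witnesses — `219 = 73·3`, `291 = 97·3`,
  `323 = 17·19` — are instances (`3¹⁸ ≡ −1 (73)`, `3²⁴ ≡ −1 (97)`, `19⁴ ≡ −1 (17)`; `thetaSecant_yesList_400_quartic`), so EVERY two-prime row `p·q < 400` of the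
  census is decided by symbols (21 by `(p/q) = −1`, 3 by `(q/p)₄ = −1`, 14 NO by `p ≡ 5 (mod 8)` ∧ `(q/p) = +1`); only the four three-prime rows `195, 231, 255, 399`
  are left; of these `195, 231, 255` are DATA-FREE by the predecessor's LOCAL OBSTRUCTION CRITERION (`thetaSecant_reaches_195/231/255_by_local_obstruction`:
  every factorisation obstructed at one prime), while `399` is the criterion's own honest limit (`thetaSecant_local_criterion_silent_at_399`: reached, `20² = 399 + 1`,
  yet `(3, 133)` is unobstructed at every admissible modulus) — the ONE row of 82 whose reach rests on its witness. NEW HONEST LIMIT of the symbols (kernel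
  negative control, `thetaSecant_quartic_undecided`): with `(q/p)₄ = +1` both outcomes occur — `799 = 17·47`
  (`47⁴ ≡ 1 (17)`) IS reached (`(424, 15)`), `579 = 193·3` (`3⁴⁸ ≡ 1 (193)`) is NOT (certificate `(3, 193, 8, 1)`): the next symbol in the tower is not
  typed here. COMPOSITION (`weilAlgebraicAll_two_twoPrimes_quartic_…`, tier of `MethodInstanceG6ThetaSecantReachLaw.lean` §5: `weilFamilyReach_hyperbolic`
  ∧ `PerfectComplexRankTransfer C` BY NAME, m-uniform seed BY VALUE): algebraic Weil classes on all `ℚ(√-pq)`-Weil fourfolds of this family — in print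
  [Markman2025SecantWeil] Cor. 1.6.1 (PREPRINT); nothing new is claimed about Weil classes.
Classical number theory (Dirichlet/Scholz-type use of the biquadratic symbol); proved here in full: 0 `def`, 0 `sorry`, 0 named fact.
-/

noncomputable section

open CategoryTheory AlgebraicGeometry
open Literature.AlgebraicGeometry.Motives Literature.AlgebraicGeometry.HodgeTheory
open Literature.AlgebraicGeometry.ModuliOfAbelianVarieties Literature.AlgebraicGeometry.Deligne1982
open Literature.AlgebraicGeometry.KTheory
open Literature.AlgebraicTopology.SingularHomology
open NumberTheorySymbols

namespace Summit.Ventures.HSemireg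

section Quartic

open Pell

/-! ## §1 A Jacobi lemma -/

/-- **`n ∣ p·v² − 1` ⟹ `J(p | n) = 1`**: `J(p·v² | n) = J(1 | n) = 1` and `J(v² | n) = 1` (`v` is prime to `n`). No parity or primality needed (Mathlib's
`jacobiSym` conventions for even `n` included). [bookkeeping] -/
theorem jacobiSym_eq_one_of_dvd_mul_sq_sub_one {p v n : ℕ} (h : (n : ℤ) ∣ (p : ℤ) * (v : ℤ) ^ 2 - 1) : J((p : ℤ) | n) = 1 := by
  obtain ⟨t, ht⟩ := h
  have hcop : Int.gcd (v : ℤ) n = 1 := Int.isCoprime_iff_gcd_eq_one.1 ⟨(p : ℤ) * v, -t, by linear_combination ht⟩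
  have h1 : J((p : ℤ) * (v : ℤ) ^ 2 | n) = 1 := by
    rw [jacobiSym.mod_left' (a₂ := 1) (by rw [show (p : ℤ) * (v : ℤ) ^ 2 = 1 + n * t by linear_combination ht, Int.add_mul_emod_self_left]),
      jacobiSym.one_left]
  rwa [jacobiSym.mul_left, jacobiSym.sq_one' hcop, mul_one] at h1

/-! ## §2 The quartic supplement -/

/-- **A certificate forces `(q/p)₄ = +1`.** For primes `p ≡ 1 (mod 8)`, `q ≡ 3 (mod 4)`: a NO certificate `a·b = p·q`, `1 < b`, `b·v² = a·u² + 1` (necessarily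
`(a, b) = (q, p)`) gives `q^{(p−1)/4} = 1` in `ZMod p` (exponent written `p / 4`, equal to `(p − 1)/4` for `p ≡ 1 (mod 8)`). [bookkeeping] -/
theorem thetaSecant_quartic_residue_of_certificate {p q : ℕ} (hp : p.Prime) (hq : q.Prime) (hp8 : p % 8 = 1) (hq4 : q % 4 = 3)
    {a b u v : ℕ} (hab : a * b = p * q) (hb : 1 < b) (hcert : b * v ^ 2 = a * u ^ 2 + 1) :
    ((q : ℕ) : ZMod p) ^ (p / 4) = 1 := by
  haveI := Fact.mk hp
  have hp4 : p % 4 = 1 := by omega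
  have hp2 : p ≠ 2 := by
    rintro rfl
    omega
  obtain ⟨ha, hb', -⟩ := thetaSecant_certificate_shape_two_primes hp hq hp4 hq4 hab hb hcert
  subst a b
  -- `hcert : p * v ^ 2 = q * u ^ 2 + 1`
  have hu0 : u ≠ 0 := by
    rintro rfl
    simp only [ne_eq, OfNat.ofNat_ne_zero, not_false_eq_true, zero_pow, mul_zero, zero_add] at hcert
    exact hp.one_lt.ne' (Nat.eq_one_of_mul_eq_one_right hcert)
  obtain ⟨e, u', hu', rfl⟩ := Nat.exists_eq_two_pow_mul_odd hu0
  -- mod `p`: `q·u² = −1`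
  have hqu : ((q : ℕ) : ZMod p) * ((2 ^ e * u' : ℕ) : ZMod p) ^ 2 = -1 := by
    have e0 := congrArg (Nat.cast : ℕ → ZMod p) hcert
    push_cast at e0
    rw [ZMod.natCast_self, zero_mul] at e0
    have e1 : ((q : ℕ) : ZMod p) * ((2 ^ e * u' : ℕ) : ZMod p) ^ 2 + 1 = 0 := by push_cast; exact e0.symm
    exact eq_neg_of_add_eq_zero_left e1
  -- `(u/p) = 1`: the odd part by Jacobi reciprocity + §1, the power of two by `p ≡ 1 (mod 8)`
  have hz : (p : ℤ) * (v : ℤ) ^ 2 - 1 = (u' : ℤ) * ((q : ℤ) * (2 ^ e : ℤ) ^ 2 * u') := by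
    have e0 : ((p * v ^ 2 : ℕ) : ℤ) = ((q * (2 ^ e * u') ^ 2 + 1 : ℕ) : ℤ) := by exact_mod_cast hcert
    push_cast at e0
    linear_combination e0
  have hJ : J((u' : ℤ) | p) = 1 := by
    rw [jacobiSym.quadratic_reciprocity_one_mod_four' hu' hp4]
    exact jacobiSym_eq_one_of_dvd_mul_sq_sub_one ⟨_, hz⟩
  have hL' : legendreSym p u' = 1 := by rw [jacobiSym.legendreSym.to_jacobiSym]; exact hJ
  have hL2 : legendreSym p 2 = 1 := by
    rw [legendreSym.at_two hp2, ZMod.χ₈_nat_eq_if_mod_eight]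
    simp [hp8, show p % 2 = 1 by omega]
  have hL : legendreSym p ((2 ^ e * u' : ℕ) : ℤ) = 1 := by
    have hpow : legendreSym p ((2 : ℤ) ^ e) = legendreSym p 2 ^ e := by
      have := map_pow (legendreSym.hom p) 2 e
      simpa only [legendreSym.hom_apply] using this
    push_cast
    rw [legendreSym.mul, hpow, hL2, hL', one_pow, mul_one]
  -- Euler's criterion: `u^{(p−1)/2} = 1`
  have hE : ((2 ^ e * u' : ℕ) : ZMod p) ^ (p / 2) = 1 := by
    have := legendreSym.eq_pow p ((2 ^ e * u' : ℕ) : ℤ)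
    rw [hL] at this
    push_cast at this ⊢
    exact this.symm
  -- `q^{(p−1)/4} · u^{(p−1)/2} = (q·u²)^{(p−1)/4} = (−1)^{even} = 1`
  have hev : Even (p / 4) := Nat.even_iff.2 (by omega)
  have key : ((q : ℕ) : ZMod p) ^ (p / 4) * (((2 ^ e * u' : ℕ) : ZMod p) ^ 2) ^ (p / 4) = 1 := by
    rw [← mul_pow, hqu, hev.neg_one_pow]
  rwa [← pow_mul, show 2 * (p / 4) = p / 2 by omega, hE, mul_one] at key

/-- **NO CERTIFICATE when `(q/p)₄ = −1`** (`p ≡ 1 (mod 8)`, `q ≡ 3 (mod 4)` primes, `q^{(p−1)/4} = −1` in `ZMod p`). [bookkeeping] -/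
theorem thetaSecant_noCertificate_two_primes_of_quartic_nonresidue {p q : ℕ} (hp : p.Prime) (hq : q.Prime) (hp8 : p % 8 = 1) (hq4 : q % 4 = 3)
    (h4 : ((q : ℕ) : ZMod p) ^ (p / 4) = -1) :
    ¬ ∃ a b u v : ℕ, a * b = p * q ∧ 1 < b ∧ b * v ^ 2 = a * u ^ 2 + 1 := by
  haveI := Fact.mk hp
  rintro ⟨a, b, u, v, hab, hb, hcert⟩
  have h1 := thetaSecant_quartic_residue_of_certificate hp hq hp8 hq4 hab hb hcert
  rw [h1] at h4
  exact Ring.neg_one_ne_one_of_char_ne_two (by rw [ZMod.ringChar_zmod_n]; omega) h4.symm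

/-- **THE QUARTIC SUPPLEMENT.** Primes `p ≡ 1 (mod 8)`, `q ≡ 3 (mod 4)` with `q^{(p−1)/4} ≡ −1 (mod p)` (`q` a quadratic but not a quartic residue:
`(q/p) = +1`, `(q/p)₄ = −1`): some EVEN `m` and odd `k` satisfy `m² = p·q·k² + 1` — `ℚ(√-pq)` IS REACHED, with no Pell computation. Instances: `219 = 73·3`,
`291 = 97·3`, `323 = 17·19`, `723 = 241·3`, `731 = 17·43`, … [bookkeeping] -/
theorem thetaSecant_reaches_two_primes_of_quartic_nonresidue {p q : ℕ} (hp : p.Prime) (hq : q.Prime) (hp8 : p % 8 = 1) (hq4 : q % 4 = 3)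
    (h4 : ((q : ℕ) : ZMod p) ^ (p / 4) = -1) : ∃ m k : ℕ, Even m ∧ Odd k ∧ m ^ 2 = p * q * k ^ 2 + 1 := by
  obtain ⟨m, k, hm, hmk⟩ := (thetaSecant_reach_iff_no_certificate_of_mod_four_eq_three (two_primes_mod_four (by omega) hq4)).2
    (thetaSecant_noCertificate_two_primes_of_quartic_nonresidue hp hq hp8 hq4 h4)
  exact ⟨m, k, hm, Nat.odd_iff.2 (mod_four_eq_three_of_even_of_pell hm hmk).2, hmk⟩

/-! ## §3 The table's last two-prime rows, the new honest limit, one composition -/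

/-- **The three quadratic-open YES rows below `400` are quartic instances**: `(p, q) = (73, 3), (97, 3), (17, 19)` (`d = 219, 291, 323`) have `q^{(p−1)/4} ≡ −1
(mod p)` (`decide`), so they are reached with no witness. With the sequel's data-free lists this decides EVERY two-prime row `p·q < 400` by symbols.
[bookkeeping] -/
theorem thetaSecant_yesList_400_quartic :
    ∀ t ∈ ([(73, 3), (97, 3), (17, 19)] : List (ℕ × ℕ)), ∃ m k : ℕ, Even m ∧ Odd k ∧ m ^ 2 = t.1 * t.2 * k ^ 2 + 1 := by
  intro t ht
  simp only [List.mem_cons, List.mem_nil_iff, or_false] at ht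
  rcases ht with rfl | rfl | rfl
  · exact thetaSecant_reaches_two_primes_of_quartic_nonresidue (p := 73) (q := 3) (by norm_num) (by norm_num) rfl rfl (by decide)
  · exact thetaSecant_reaches_two_primes_of_quartic_nonresidue (p := 97) (q := 3) (by norm_num) (by norm_num) rfl rfl (by decide)
  · exact thetaSecant_reaches_two_primes_of_quartic_nonresidue (p := 17) (q := 19) (by norm_num) (by norm_num) rfl rfl (by decide)

/-- **NEW HONEST LIMIT (kernel negative control).** With `(q/p)₄ = +1` both outcomes occur: `799 = 17·47` (`47⁴ = 1` in `ZMod 17`) IS reached — witness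
`(424, 15)` — while `579 = 193·3` (`3⁴⁸ = 1` in `ZMod 193`) is NOT — certificate `(3, 193, 8, 1)`. So `(q/p)₄ = −1` is sufficient, not necessary, and the
converse of `thetaSecant_quartic_residue_of_certificate` fails; the next symbol of the tower is not typed. [bookkeeping] -/
theorem thetaSecant_quartic_undecided :
    (((47 : ℕ) : ZMod 17) ^ (17 / 4) = 1 ∧ ∃ m k : ℕ, Even m ∧ m ^ 2 = 17 * 47 * k ^ 2 + 1) ∧
    (((3 : ℕ) : ZMod 193) ^ (193 / 4) = 1 ∧ ∀ m k : ℕ, m ^ 2 = 193 * 3 * k ^ 2 + 1 → ¬ Even m ∧ Even k) := by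
  refine ⟨⟨by decide, 424, 15, ⟨212, rfl⟩, by norm_num⟩, by decide, fun m k hmk ↦ ?_⟩
  exact thetaSecant_noReach_of_certificate (a := 3) (b := 193) (u := 8) (v := 1) (Nat.odd_iff.2 rfl) rfl (by norm_num) rfl hmk

/-- **A three-prime row, data-free, by the local obstruction criterion** (`thetaSecant_reach_of_local_obstruction`): `195 = 3·5·13` is reached with NO
witness — each of its seven factorisations `(a, b)`, `1 < b`, is obstructed: `(65, 3)`: `3` non-square mod `5`; `(39, 5)`: `5` non-square mod `3`; `(15, 13)`:
`−15` non-square mod `13`; `(13, 15)`: `15` non-square mod `13`; `(5, 39)`: `−5` non-square mod `13`; `(3, 65)`: `65` non-square mod `3`; `(1, 195)`: `−1`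
non-square mod `3`. [bookkeeping] -/
theorem thetaSecant_reaches_195_by_local_obstruction : ∃ m k : ℕ, Even m ∧ m ^ 2 = 195 * k ^ 2 + 1 := by
  refine thetaSecant_reach_of_local_obstruction rfl fun a b hab hb ↦ ?_
  have hmem : b ∈ Nat.divisors 195 := Nat.mem_divisors.2 ⟨⟨a, by rw [mul_comm]; exact hab.symm⟩, by norm_num⟩
  have hdiv : Nat.divisors 195 = {1, 3, 5, 13, 15, 39, 65, 195} := by decide
  rw [hdiv] at hmem
  simp only [Finset.mem_insert, Finset.mem_singleton] at hmem
  rcases hmem with rfl | rfl | rfl | rfl | rfl | rfl | rfl | rfl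
  · omega
  · obtain rfl : a = 65 := by omega
    exact Or.inl ⟨5, by norm_num, by decide⟩
  · obtain rfl : a = 39 := by omega
    exact Or.inl ⟨3, by norm_num, by decide⟩
  · obtain rfl : a = 15 := by omega
    exact Or.inr ⟨13, dvd_rfl, by decide⟩
  · obtain rfl : a = 13 := by omega
    exact Or.inl ⟨13, dvd_rfl, by decide⟩
  · obtain rfl : a = 5 := by omega
    exact Or.inr ⟨13, by norm_num, by decide⟩
  · obtain rfl : a = 3 := by omega
    exact Or.inl ⟨3, dvd_rfl, by decide⟩
  · obtain rfl : a = 1 := by omega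
    exact Or.inr ⟨3, by norm_num, by decide⟩

/-- **`231 = 3·7·11`, data-free**: its factorisations `(77,3), (33,7), (21,11), (11,21), (7,33), (3,77), (1,231)` are obstructed mod `7, 11, 3, 11, 7, 3, 3`
respectively (`3 ∤□ 7`, `7 ∤□ 11`, `11 ≡ 2 ∤□ 3`, `21 ≡ 10 ∤□ 11`, `33 ≡ 5 ∤□ 7`, `77 ≡ 2 ∤□ 3`, `−1 ∤□ 3`). [bookkeeping] -/
theorem thetaSecant_reaches_231_by_local_obstruction : ∃ m k : ℕ, Even m ∧ m ^ 2 = 231 * k ^ 2 + 1 := by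
  refine thetaSecant_reach_of_local_obstruction rfl fun a b hab hb ↦ ?_
  have hmem : b ∈ Nat.divisors 231 := Nat.mem_divisors.2 ⟨⟨a, by rw [mul_comm]; exact hab.symm⟩, by norm_num⟩
  have hdiv : Nat.divisors 231 = {1, 3, 7, 11, 21, 33, 77, 231} := by decide
  rw [hdiv] at hmem
  simp only [Finset.mem_insert, Finset.mem_singleton] at hmem
  rcases hmem with rfl | rfl | rfl | rfl | rfl | rfl | rfl | rfl
  · omega
  · obtain rfl : a = 77 := by omega
    exact Or.inl ⟨7, by norm_num, by decide⟩
  · obtain rfl : a = 33 := by omega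
    exact Or.inl ⟨11, by norm_num, by decide⟩
  · obtain rfl : a = 21 := by omega
    exact Or.inl ⟨3, by norm_num, by decide⟩
  · obtain rfl : a = 11 := by omega
    exact Or.inl ⟨11, dvd_rfl, by decide⟩
  · obtain rfl : a = 7 := by omega
    exact Or.inl ⟨7, dvd_rfl, by decide⟩
  · obtain rfl : a = 3 := by omega
    exact Or.inl ⟨3, dvd_rfl, by decide⟩
  · obtain rfl : a = 1 := by omega
    exact Or.inr ⟨3, by norm_num, by decide⟩

/-- **`255 = 3·5·17`, data-free**: its factorisations `(85,3), (51,5), (17,15), (15,17), (5,51), (3,85), (1,255)` are obstructed mod `5, 3, 5, 3, 17, 5, 3`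
respectively (`3 ∤□ 5`, `5 ≡ 2 ∤□ 3`, `−17 ≡ 3 ∤□ 5`, `17 ≡ 2 ∤□ 3`, `−5 ≡ 12 ∤□ 17`, `−3 ≡ 2 ∤□ 5`, `−1 ∤□ 3`). [bookkeeping] -/
theorem thetaSecant_reaches_255_by_local_obstruction : ∃ m k : ℕ, Even m ∧ m ^ 2 = 255 * k ^ 2 + 1 := by
  refine thetaSecant_reach_of_local_obstruction rfl fun a b hab hb ↦ ?_
  have hmem : b ∈ Nat.divisors 255 := Nat.mem_divisors.2 ⟨⟨a, by rw [mul_comm]; exact hab.symm⟩, by norm_num⟩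
  have hdiv : Nat.divisors 255 = {1, 3, 5, 15, 17, 51, 85, 255} := by decide
  rw [hdiv] at hmem
  simp only [Finset.mem_insert, Finset.mem_singleton] at hmem
  rcases hmem with rfl | rfl | rfl | rfl | rfl | rfl | rfl | rfl
  · omega
  · obtain rfl : a = 85 := by omega
    exact Or.inl ⟨5, by norm_num, by decide⟩
  · obtain rfl : a = 51 := by omega
    exact Or.inl ⟨3, by norm_num, by decide⟩
  · obtain rfl : a = 17 := by omega
    exact Or.inr ⟨5, by norm_num, by decide⟩
  · obtain rfl : a = 15 := by omega
    exact Or.inl ⟨3, by norm_num, by decide⟩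
  · obtain rfl : a = 5 := by omega
    exact Or.inr ⟨17, by norm_num, by decide⟩
  · obtain rfl : a = 3 := by omega
    exact Or.inr ⟨5, by norm_num, by decide⟩
  · obtain rfl : a = 1 := by omega
    exact Or.inr ⟨3, by norm_num, by decide⟩

/-- **HONEST LIMIT of the local criterion: `399 = 3·7·19`.** The row IS reached (`20² = 399·1² + 1`), but its factorisation `(a, b) = (3, 133)` is obstructed at NO
modulus allowed by `thetaSecant_reach_of_local_obstruction`: `133` is a square mod every `ℓ ∣ 3`, and `−3` is a square mod every `ℓ ∣ 133` (`−3 ≡ 2²`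
mod `7`, `≡ 4²` mod `19`, `≡ 23²` mod `133`). So the single-modulus obstructions are sufficient, not necessary: `399` is the one row below `400` whose reach rests on
its witness in the kernel (globally, `133·v² − 3·u² = 1` has no solution although it is unobstructed prime by prime). [bookkeeping] -/
theorem thetaSecant_local_criterion_silent_at_399 :
    (∀ ℓ : ℕ, ℓ ∣ 3 → IsSquare ((133 : ℕ) : ZMod ℓ)) ∧ (∀ ℓ : ℕ, ℓ ∣ 133 → IsSquare (-((3 : ℕ) : ZMod ℓ))) ∧
    (3 * 133 = 399 ∧ 1 < 133) ∧ ∃ m k : ℕ, Even m ∧ m ^ 2 = 399 * k ^ 2 + 1 := by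
  refine ⟨fun ℓ hl ↦ ?_, fun ℓ hl ↦ ?_, ⟨rfl, by norm_num⟩, 20, 1, ⟨10, rfl⟩, by norm_num⟩
  · have hmem : ℓ ∈ Nat.divisors 3 := Nat.mem_divisors.2 ⟨hl, by norm_num⟩
    have hdiv : Nat.divisors 3 = {1, 3} := by decide
    rw [hdiv] at hmem
    simp only [Finset.mem_insert, Finset.mem_singleton] at hmem
    rcases hmem with rfl | rfl
    · exact ⟨0, by decide⟩
    · exact ⟨1, by decide⟩
  · have hmem : ℓ ∈ Nat.divisors 133 := Nat.mem_divisors.2 ⟨hl, by norm_num⟩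
    have hdiv : Nat.divisors 133 = {1, 7, 19, 133} := by decide
    rw [hdiv] at hmem
    simp only [Finset.mem_insert, Finset.mem_singleton] at hmem
    rcases hmem with rfl | rfl | rfl | rfl
    · exact ⟨0, by decide⟩
    · exact ⟨2, by decide⟩
    · exact ⟨4, by decide⟩
    · exact ⟨23, by decide⟩

end Quartic

section Reach

open Pell
open Summit.HodgeConjecture.HodgeConjecture
open Summit.HodgeConjecture.HodgeConjecture.WeilTypeLadder
open Summit.HodgeConjecture.HodgeConjecture.Cruxes.HodgeAbelianVarieties.EStepSecantInduction
open Summit.Ventures.HSemireg.GeneralStructure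

variable {C : ChernCharacterBetti}

/-- **CLOSED-FORM REACH, quartic family** (tier of `hrow` exactly as in
`weilAlgebraicAll_two_of_reach_of_perfectComplexRankTransfer_of_thetaSecantSeeds_of_oddFundamental`: the theta-secant rows as level-3 hyperbolic
rank-class seeds uniformly in even `m`, BY VALUE — an extrapolation beyond the rows of record; `weilFamilyReach_hyperbolic` ∧ `PerfectComplexRankTransfer C`
BY NAME): for primes `p ≡ 1 (mod 8)`, `q ≡ 3 (mod 4)` with `q^{(p−1)/4} ≡ −1 (mod p)`, ALL `ℚ(√-pq)`-Weil abelian FOURFOLDS have algebraic Weil classes. In print: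
[Markman2025SecantWeil] Cor. 1.6.1 (PREPRINT, every `d`); nothing about non-split sixfolds. [cite: Markman2025SecantWeil, Cor. 1.6.1 (preprint)]
[cite: Deligne1982HodgeCycles, proof of Thm. 4.8] -/
theorem weilAlgebraicAll_two_twoPrimes_quartic_of_reach_of_perfectComplexRankTransfer_of_thetaSecantSeeds
    (hF : weilFamilyReach_hyperbolic) (hT : PerfectComplexRankTransfer C)
    (hrow : ∀ m : ℕ, Even m → 2 ≤ m → HasHyperbolicSeedOn (rankObjClass C) 3 (m ^ 2 - 1))
    {p q : ℕ} (hp : p.Prime) (hq : q.Prime) (hp8 : p % 8 = 1) (hq4 : q % 4 = 3) (h4 : ((q : ℕ) : ZMod p) ^ (p / 4) = -1) :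
    WeilAlgebraicAll 2 (p * q) := by
  have hd3 : p * q % 4 = 3 := two_primes_mod_four (by omega) hq4
  have hd : Odd (p * q) := Nat.odd_iff.2 (Nat.odd_of_mod_four_eq_three hd3)
  obtain ⟨a₁, h⟩ := pell_exists_isFundamental_of_mod_four_eq_three hd3
  obtain ⟨m, k, hm, -, hmk⟩ := thetaSecant_reaches_two_primes_of_quartic_nonresidue hp hq hp8 hq4 h4
  exact weilAlgebraicAll_two_of_reach_of_perfectComplexRankTransfer_of_thetaSecantSeeds_of_oddFundamental hF hT hrow hd h
    ((thetaSecant_reach_iff_odd_fundamental_y hd h).1 ⟨m, k, hm, hmk⟩)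

end Reach

/-! ## Audit: nothing is decided here
KERNEL: §1 a Jacobi lemma, §2 the quartic supplement (a certificate forces `(q/p)₄ = +1`; `(q/p)₄ = −1` ⟹ reached), §3 the three quadratic-open YES rows
below `400` as instances, the honest limit at `(q/p)₄ = +1` (`799` vs `579`), the three-prime rows `195, 231, 255` data-free by local obstruction and the
criterion's silence at `399`, one composition with the landed cell theorem (BY NAME there:
`weilFamilyReach_hyperbolic`, `PerfectComplexRankTransfer C`; BY VALUE: the m-uniform theta-secant seed). Not here: `(q/p)₄ = +1` (undecided at this level),
three or more prime factors, any non-split sixfold, HC_CM, `σ ∘ ob = ⌟ch`. -/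

end Summit.Ventures.HSemireg

end
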